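import Literature.Algebra.Homology.EulerCharacteristicShortExact
import Literature.Algebra.Lie.RadicalKillingOrthogonal
import Mathlib.LinearAlgebra.Trace
import HarnessLib

/-!
# Trace bookkeeping of an endomorphism of a short complex of vector spaces (LEAF 1 of the Hopf trace formula)

Layer `Literature/Algebra/Homology` (pure linear algebra over Mathlib; proved theorems only, 0 definitions, 0 named facts, no
instances, no notation). For a short complex `S : X₁ —f→ X₂ —g→ X₃` of vector spaces over a field `K` with `X₂`
finite-dimensional (Mathlib `ShortComplex (ModuleCat K)`) and an ENDOMORPHISM `ψ : S ⟶ S`: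

* invariance: `ker g`, `range f ⊆ X₂` are `ψ.τ₂`-stable, `range g ⊆ X₃` is `ψ.τ₃`-stable (`mapsTo_ker_g`, `mapsTo_range_f`,
  `mapsTo_range_g`, `mapsTo_range_moduleCatToCycles`);
* `trace_mapQ_ker_g_eq` — `tr(ψ.τ₂ mod ker g) = tr(ψ.τ₃ | range g)` (conjugation by `LinearMap.quotKerEquivRange`);
* `trace_restrict_range_toCycles_eq` — `tr(ψ.τ₂|_{ker g} | range(X₁ → ker g)) = tr(ψ.τ₂ | range f)`;
* `trace_mapQ_range_toCycles_eq` — `tr(ψ.τ₂|_{ker g} mod range(X₁ → ker g)) = tr(H(ψ) : S.homology → S.homology)` (the equivariance of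
  Mathlib's `ShortComplex.moduleCatHomologyIso`, checked on `homologyπ`);
* **`trace_τ₂_eq : tr ψ.τ₂ = tr H(ψ) + tr(ψ.τ₃ | range g) + tr(ψ.τ₂ | range f)`** — TWO applications of the tree's
  trace-along-an-invariant-subspace lemma `Literature.Algebra.Lie.trace_eq_trace_restrict_add_trace_mapQ`
  (`tr u = tr(u|_p) + tr(u mod p)`, CITED AND USED, not re-derived), on `ker g ⊆ X₂` and on `range(X₁ → ker g) ⊆ ker g`.

With `ψ = 𝟙` this is row `EulerPoincareFormula`'s `finrank_X₂_eq_finrank_homology_add` (`tr 𝟙 = dim`), which is not restated. LEAF 2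
(`HopfTraceFormula`) sums it over a complex. Library only (cell `pub-hodge-ring2`, count-neutral); proves nothing about any crux,
route or conjecture.

## References

* A. Hatcher, *Algebraic Topology* (2002), §2.C, Thm. 2C.3 (Hopf trace formula) and its proof. [HatcherAT2002]
* E. H. Spanier, *Algebraic Topology* (1966/1981), Ch. 4 §7, Thm. 6. [Spanier1981]
* N. Bourbaki, *Lie groups and Lie algebras* I §4 no. 3 (trace in a basis adapted to a stable flag). [Bourbaki1989LieGroups13]
-/

open CategoryTheory CategoryTheory.Limits

universe v u

namespace Literature.Algebra.Homology.HopfTrace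

variable {K : Type u} [Field K] (S : ShortComplex (ModuleCat.{v} K)) (ψ : S ⟶ S)

/-! ### Invariance of the three subspaces -/

/-- `g (τ₂ x) = τ₃ (g x)`. [cite: HatcherAT2002, Thm. 2C.3 (proof)] -/
theorem g_τ₂_apply (x : S.X₂) : S.g.hom (ψ.τ₂.hom x) = ψ.τ₃.hom (S.g.hom x) := by
  have h := congrArg (fun φ => φ.hom x) ψ.comm₂₃
  simpa only [ModuleCat.hom_comp, LinearMap.comp_apply] using h

/-- `f (τ₁ x) = τ₂ (f x)`. [cite: HatcherAT2002, Thm. 2C.3 (proof)] -/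
theorem f_τ₁_apply (x : S.X₁) : S.f.hom (ψ.τ₁.hom x) = ψ.τ₂.hom (S.f.hom x) := by
  have h := congrArg (fun φ => φ.hom x) ψ.comm₁₂
  simpa only [ModuleCat.hom_comp, LinearMap.comp_apply] using h

/-- `ker g` is `τ₂`-stable. [cite: HatcherAT2002, Thm. 2C.3 (proof)] -/
theorem mapsTo_ker_g : ∀ x ∈ LinearMap.ker S.g.hom, ψ.τ₂.hom x ∈ LinearMap.ker S.g.hom := by
  intro x hx
  rw [LinearMap.mem_ker] at hx ⊢
  rw [g_τ₂_apply, hx, map_zero]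

/-- `range f` is `τ₂`-stable. [cite: HatcherAT2002, Thm. 2C.3 (proof)] -/
theorem mapsTo_range_f : ∀ x ∈ LinearMap.range S.f.hom, ψ.τ₂.hom x ∈ LinearMap.range S.f.hom := by
  rintro _ ⟨x, rfl⟩
  exact ⟨ψ.τ₁.hom x, f_τ₁_apply S ψ x⟩

/-- `range g` is `τ₃`-stable. [cite: HatcherAT2002, Thm. 2C.3 (proof)] -/
theorem mapsTo_range_g : ∀ x ∈ LinearMap.range S.g.hom, ψ.τ₃.hom x ∈ LinearMap.range S.g.hom := by
  rintro _ ⟨x, rfl⟩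
  exact ⟨ψ.τ₂.hom x, g_τ₂_apply S ψ x⟩

/-- The image of `X₁ → ker g` is stable under `τ₂|_{ker g}`. [cite: HatcherAT2002, Thm. 2C.3 (proof)] -/
theorem mapsTo_range_moduleCatToCycles :
    ∀ x ∈ LinearMap.range S.moduleCatToCycles, ψ.τ₂.hom.restrict (mapsTo_ker_g S ψ) x ∈ LinearMap.range S.moduleCatToCycles := by
  rintro _ ⟨x, rfl⟩
  refine ⟨ψ.τ₁.hom x, Subtype.ext ?_⟩
  change S.f.hom (ψ.τ₁.hom x) = ψ.τ₂.hom (S.f.hom x)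
  exact f_τ₁_apply S ψ x

/-! ### The three traces -/

/-- **`tr(τ₂ mod ker g) = tr(τ₃ | range g)`** (`X₂ ⁄ ker g ≅ range g` equivariantly). [cite: HatcherAT2002, Thm. 2C.3 (proof)] -/
theorem trace_mapQ_ker_g_eq :
    LinearMap.trace K _ ((LinearMap.ker S.g.hom).mapQ (LinearMap.ker S.g.hom) ψ.τ₂.hom (mapsTo_ker_g S ψ)) =
      LinearMap.trace K _ (ψ.τ₃.hom.restrict (mapsTo_range_g S ψ)) := by
  rw [← LinearMap.trace_conj' _ S.g.hom.quotKerEquivRange]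
  congr 1
  refine LinearMap.ext fun y => ?_
  obtain ⟨x, hx⟩ := y.2
  have hy : y = ⟨S.g.hom x, ⟨x, rfl⟩⟩ := Subtype.ext hx.symm
  subst hy
  rw [LinearEquiv.conj_apply_apply, LinearMap.quotKerEquivRange_symm_apply_image, Submodule.mkQ_apply, Submodule.mapQ_apply]
  apply Subtype.ext
  rw [LinearMap.quotKerEquivRange_apply_mk, LinearMap.coe_restrict_apply]
  exact g_τ₂_apply S ψ x

/-- `range(X₁ → ker g)`, pushed into `X₂`, is `range f`. [cite: HatcherAT2002, Thm. 2C.3 (proof)] -/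
theorem map_subtype_range_moduleCatToCycles :
    (LinearMap.range S.moduleCatToCycles).map (LinearMap.ker S.g.hom).subtype = LinearMap.range S.f.hom := by
  rw [← LinearMap.range_comp, LinearMap.subtype_comp_codRestrict]

/-- **`tr(τ₂|_{ker g} | range(X₁ → ker g)) = tr(τ₂ | range f)`**. [cite: HatcherAT2002, Thm. 2C.3 (proof)] -/
theorem trace_restrict_range_toCycles_eq :
    LinearMap.trace K _ ((ψ.τ₂.hom.restrict (mapsTo_ker_g S ψ)).restrict (mapsTo_range_moduleCatToCycles S ψ)) =
      LinearMap.trace K _ (ψ.τ₂.hom.restrict (mapsTo_range_f S ψ)) := by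
  let e : LinearMap.range S.moduleCatToCycles ≃ₗ[K] LinearMap.range S.f.hom :=
    (Submodule.equivMapOfInjective _ (LinearMap.ker S.g.hom).injective_subtype _).trans
      (LinearEquiv.ofEq _ _ (map_subtype_range_moduleCatToCycles S))
  -- `e` does not move the underlying vector of `X₂`
  have he : ∀ r : LinearMap.range S.moduleCatToCycles,
      ((e r : LinearMap.range S.f.hom) : S.X₂) = ((r : LinearMap.ker S.g.hom) : S.X₂) := fun r => rfl
  rw [← LinearMap.trace_conj' _ e]
  congr 1
  refine LinearMap.ext fun y => Subtype.ext ?_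
  have h2 : ((e (e.symm y) : LinearMap.range S.f.hom) : S.X₂) = (y : S.X₂) := by rw [LinearEquiv.apply_symm_apply]
  calc ((e.conj ((ψ.τ₂.hom.restrict (mapsTo_ker_g S ψ)).restrict (mapsTo_range_moduleCatToCycles S ψ)) y : _) : S.X₂)
      = ψ.τ₂.hom (((e.symm y : LinearMap.range S.moduleCatToCycles) : LinearMap.ker S.g.hom) : S.X₂) := by
        rw [LinearEquiv.conj_apply_apply, he]; rfl
    _ = ψ.τ₂.hom (y : S.X₂) := by rw [← he, h2]
    _ = ((ψ.τ₂.hom.restrict (mapsTo_range_f S ψ)) y : S.X₂) := rfl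

/-- **`tr(τ₂|_{ker g} mod range(X₁ → ker g)) = tr H(ψ)`** — Mathlib's `moduleCatHomologyIso : S.homology ≅ ker g ⁄ range(X₁ → ker g)`
is equivariant (checked after the surjection `homologyπ`). [cite: HatcherAT2002, Thm. 2C.3 (proof)] -/
theorem trace_mapQ_range_toCycles_eq :
    LinearMap.trace K _ ((LinearMap.range S.moduleCatToCycles).mapQ (LinearMap.range S.moduleCatToCycles)
        (ψ.τ₂.hom.restrict (mapsTo_ker_g S ψ)) (mapsTo_range_moduleCatToCycles S ψ)) =
      LinearMap.trace K S.homology (ShortComplex.homologyMap ψ).hom := by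
  let e : S.homology ≃ₗ[K] (LinearMap.ker S.g.hom ⧸ LinearMap.range S.moduleCatToCycles) := S.moduleCatHomologyIso.toLinearEquiv
  rw [← LinearMap.trace_conj' (ShortComplex.homologyMap ψ).hom e]
  congr 1
  have hsurj : Function.Surjective S.homologyπ.hom := (ModuleCat.epi_iff_surjective _).1 inferInstance
  refine LinearMap.ext fun q => ?_
  obtain ⟨h, rfl⟩ := e.surjective q
  rw [LinearEquiv.conj_apply_apply, LinearEquiv.symm_apply_apply]
  obtain ⟨z, rfl⟩ := hsurj h
  -- `e (homologyπ w) = mk (cyclesIso w)`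
  have hπ : ∀ w : S.cycles, e (S.homologyπ.hom w) = Submodule.Quotient.mk (S.moduleCatCyclesIso.hom.hom w) := by
    intro w
    have h := congrArg (fun φ => φ.hom w) S.π_moduleCatCyclesIso_hom
    simp only [ModuleCat.hom_comp, LinearMap.comp_apply] at h
    exact h
  -- naturality of `homologyπ`
  have hnat : (ShortComplex.homologyMap ψ).hom (S.homologyπ.hom z) = S.homologyπ.hom ((ShortComplex.cyclesMap ψ).hom z) := by
    have h := congrArg (fun φ => φ.hom z) (ShortComplex.homologyπ_naturality ψ)
    simpa only [ModuleCat.hom_comp, LinearMap.comp_apply] using h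
  -- `cyclesIso` intertwines `cyclesMap ψ` and `τ₂|_{ker g}` (compare the underlying vectors of `X₂`)
  have hi : ∀ w : S.cycles, S.moduleCatLeftHomologyData.i.hom (S.moduleCatCyclesIso.hom.hom w) = S.iCycles.hom w := by
    intro w
    have h := congrArg (fun φ => φ.hom w) S.moduleCatCyclesIso_hom_i
    simpa only [ModuleCat.hom_comp, LinearMap.comp_apply] using h
  have hcyc : S.moduleCatCyclesIso.hom.hom ((ShortComplex.cyclesMap ψ).hom z) =
      ψ.τ₂.hom.restrict (mapsTo_ker_g S ψ) (S.moduleCatCyclesIso.hom.hom z) := by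
    apply (LinearMap.ker S.g.hom).injective_subtype
    change S.moduleCatLeftHomologyData.i.hom _ = ψ.τ₂.hom (S.moduleCatLeftHomologyData.i.hom _)
    rw [hi, hi]
    have h := congrArg (fun φ => φ.hom z) (ShortComplex.cyclesMap_i ψ)
    simpa only [ModuleCat.hom_comp, LinearMap.comp_apply] using h
  rw [hnat, hπ, hπ, hcyc]
  rfl

/-- **Trace bookkeeping of an endomorphism of a short complex**: `tr ψ.τ₂ = tr H(ψ) + tr(ψ.τ₃ | range g) + tr(ψ.τ₂ | range f)`
(`X₂` finite-dimensional). With `ψ = 𝟙` this is `dim X₂ = dim H + rk g + rk f` (row `EulerPoincareFormula`).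
[cite: HatcherAT2002, Thm. 2C.3 (proof)] [cite: Bourbaki1989LieGroups13, Ch. I §4 no. 3 Prop. 4 (d)] -/
theorem trace_τ₂_eq [Module.Finite K S.X₂] :
    LinearMap.trace K S.X₂ ψ.τ₂.hom =
      LinearMap.trace K S.homology (ShortComplex.homologyMap ψ).hom +
        LinearMap.trace K _ (ψ.τ₃.hom.restrict (mapsTo_range_g S ψ)) +
        LinearMap.trace K _ (ψ.τ₂.hom.restrict (mapsTo_range_f S ψ)) := by
  rw [Literature.Algebra.Lie.trace_eq_trace_restrict_add_trace_mapQ ψ.τ₂.hom (LinearMap.ker S.g.hom)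
      (fun x hx => mapsTo_ker_g S ψ x hx),
    Literature.Algebra.Lie.trace_eq_trace_restrict_add_trace_mapQ (ψ.τ₂.hom.restrict (mapsTo_ker_g S ψ))
      (LinearMap.range S.moduleCatToCycles) (fun x hx => mapsTo_range_moduleCatToCycles S ψ x hx),
    trace_mapQ_ker_g_eq, trace_restrict_range_toCycles_eq, trace_mapQ_range_toCycles_eq]
  ring

end Literature.Algebra.Homology.HopfTrace
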